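/-
Copyright (c) 2026 the pub-hodgecm-mathlib formalisation cell (harness21).  Prover seat hodgecm-mathlib-F0P3a-p05 (g18): road «S3-ram» (LEAD F0P3a-plan (g13); owner∕table
F0P3a-p06 (g15∕g16); (Cnt2′) chair F0P3a-p07 (g14∕g15)), **ROW-1C IN RANK 2, CENTRED** — the W-side rank-one class dichotomy for the CENTRED monodromy `Γ − c·1` (organ (K5) of
A-p12 (g25)'s (4b) decomposition, chair RULING (13)); 2026-09-02.
-/
import Literature.NumberTheory.Automorphic.UnitaryLatticeTreeRankOneVertexOneClassTwoRamified   -- ★ p848861 (this seat) ROW-1C in rank 2 (plain); brings ★ p848802 residual tools, ★ p848050 rank-2 transitivity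
import Literature.NumberTheory.Automorphic.UnitaryLatticeTreeCentredTokensDictionary            -- ★ p848132 (this lineage, g17): `coe_inv_mul_mul_sub_smul_one_eq_conj`, `sub_smul_one_mulVec_coe_mulVec`, `forall_v_coe_conj_sub_smul_le_iff_map_le_scaleLattice`
import HarnessLib

/-!
# The lattice graph of a hermitian PLANE — ONE CLASS PER RANK-ONE VERTEX, CENTRED: the unit values `ϖ^{−d}⟨y, (Γ − c·1)y⟩` at a vertex of exact CENTRED depth `d` and rank one
# form ONE square class (Rogawski 1990 §4.9; Kottwitz 1986 §3; Labesse–Langlands 1979 §2)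

Topic `NumberTheory/Automorphic`; namespace `Literature.NumberTheory.Automorphic.UnitaryLatticeTree`.  THEOREMS ONLY (no definition, no instance, no notation, no named fact,
no `sorry`); kernel lane `--supports stmt-HodgeConjecture-24833`.  Cell `pub/hodgecm-mathlib` (D-0151), crux H413; road «S3-ram» (Literature seeding, count-neutral), the (T2)
G-side organ (Cnt2′), route B: A-p12 (g25)'s (4b) «per-kind values over the W-ball» splits the TOP shell of the region `R` (centred depth exactly `d₀ = v(½trΓ − 1)`) by the
CENTRED class `λ_B` of the traceless part — organ (K5).  At that depth the plain token `⟨y,(Γ−1)y⟩` and the centred one `⟨y,(Γ − ½trΓ·1)y⟩` differ by the UNIT `(½trΓ − 1)·⟨y,y⟩`, so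
★ ROW-1C in rank 2 (p848861, plain) does not apply verbatim; THIS FILE gives the centred twin:

* §1 **`class_xor_class_mul_stdLattice_of_symm_rankOne_two`** — the matrix form of ★ `class_xor_class_mul_stdLattice_of_rankOne_two` for ANY matrix `M` (no unitarity): entries
  `≤ |ϖ|^d`, not all `≤ |ϖ|^{d+1}`, `M²` of level `ϖ^{2d+1}`, and `J`-SYMMETRY ONE ORDER DOWN `|M_{ij} − M_{rev j,rev i}| ≤ |ϖ|^{d+1}` as a HYPOTHESIS ⇒ exactly one of the classes
  `c`, `c·ε` is taken by `x ↦ ϖ^{−d}⟨x, Mx⟩` on `𝒪²` (the residual `M̄` is `J`-symmetric, non-zero, of square zero: ★ p848802 §1).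
* §2 `exists_mem_mapGL_stdLattice_centredClass_iff_fin` — the centred class token at `u·L₀` is the one at `L₀` for `u⁻¹Γu − c·1` (any rank, any form; ★ `sub_smul_one_mulVec_coe_mulVec`).
* §3 **`class_xor_class_mul_of_selfDual_rankOne_two_centred_of_eq`** — the CENTRED VERTEX FORM: `H₂ = antidiag(1,1)` (as a hypothesis), `Γ ∈ U(σ, H₂)`, a scalar `c` with
  `|c − 1| ≤ |ϖ|^d`, `d` ODD, a self-dual `B` carrying the PLAIN level token `(Γ−1)B ⊆ ϖ^d B` (so `u⁻¹(Γ−1)u∕ϖ^d` is `J`-symmetric mod `ϖ` by unitarity, ★ p848802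
  `v_coe_sub_one_apply_sub_rev_le_of_odd_fin`, and so is the scalar `(c−1)∕ϖ^d`), exact CENTRED depth `d` (`¬(Γ − c·1)B ⊆ ϖ^{d+1}B`) and centred rank one (`(Γ − c·1)²B ⊆ ϖ^{2d+1}B`):
  for a unit `t` and a residual non-square unit `ε`, EXACTLY ONE of `CLS^c_d(t)`, `CLS^c_d(t·ε)` holds, `CLS^c_d(t)(B) :⟺ ∃ y ∈ B, a ∈ 𝒪^×, |ϖ^{−d}⟨y, (Γ − c·1)y⟩ − t·a²| < 1`.

HONEST LABEL: HC_CM is proved only modulo the 2 remaining named inputs (hLiu418 24832, h413 24833) until rung 0 closes; nothing printed is asserted here (elementary algebra over a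
valuation ring and a finite field); «S3-ram» has no books consequence.

## References
* [Rogawski1990] J. D. Rogawski, *Automorphic Representations of Unitary Groups in Three Variables*, Ann. of Math. Stud. 123 (1990), §4.9 pp. 54–55 (the two rank-one classes).
* [Kottwitz1986] R. E. Kottwitz, *Base change for unit elements of Hecke algebras*, Compositio Math. 60 (1986), §3 (counting fixed lattices by residual data).
* [LabesseLanglands1979] J.-P. Labesse, R. P. Langlands, *L-indistinguishability for SL(2)*, Canad. J. Math. 31 (1979), §2 Lemma 2.1 (the centred monodromy of an elliptic element).
* [BruhatTits1972] F. Bruhat, J. Tits, *Groupes réductifs sur un corps local I*, Publ. Math. IHÉS 41 (1972), §10.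
-/

set_option autoImplicit false

noncomputable section

open scoped Valued WithZero Matrix MatrixGroups

namespace Literature.NumberTheory.Automorphic.UnitaryLatticeTree

open Literature.NumberTheory.Automorphic Literature.NumberTheory.Automorphic.HermitianLattice

variable {K : Type*} [Field K] [Valued K ℤᵐ⁰] {σ : K →+* K} {ϖ : K}

/-! ## §1 The matrix form for any `J`-symmetric-one-order-down matrix -/

/-- **ONE CLASS AT THE ROOT, RANK 2, FOR ANY MATRIX (symmetry as a hypothesis).**  `M ∈ M₂(K)` with `|M_{ij}| ≤ |ϖ|^d` (`d ≥ 1`), NOT all `≤ |ϖ|^{d+1}`, `|(M²)_{ij}| ≤ |ϖ|^{2d+1}`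
and `|M_{ij} − M_{rev j, rev i}| ≤ |ϖ|^{d+1}`; a unit `c` and a residual non-square unit `ε` (`|2| = 1`, `σ` residually trivial, `𝓀` finite): EXACTLY ONE of the classes `c`, `c·ε` is
taken by `x ↦ ϖ^{−d}⟨x, Mx⟩_{J₂}` on `𝒪²` to first order (★ p848802 §1: `M̄` is `J`-symmetric, non-zero, of square zero, so its form is `s₀·ℓ²`).  ★ p848861
`class_xor_class_mul_stdLattice_of_rankOne_two` is the case `M = Γ − 1`, `Γ` unitary. [cite: Rogawski1990, §4.9 p. 55] [cite: Kottwitz1986, §3] [cite: BruhatTits1972, §10] -/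
theorem class_xor_class_mul_stdLattice_of_symm_rankOne_two (hvσ : ∀ a, Valued.v (σ a) = Valued.v a)
    (hϖ : Valued.v ϖ = WithZero.exp (-1 : ℤ)) (hres : ∀ x : K, Valued.v x ≤ 1 → Valued.v (σ x - x) < 1) (h2 : Valued.v (2 : K) = 1) [Finite 𝓀[K]]
    (M : Matrix (Fin 2) (Fin 2) K) {d : ℕ}
    (hM : ∀ i j, Valued.v (M i j) ≤ Valued.v ϖ ^ d)
    (hM' : ¬ ∀ i j, Valued.v (M i j) ≤ Valued.v ϖ ^ (d + 1))
    (hsq : ∀ i j, Valued.v ((M * M) i j) ≤ Valued.v ϖ ^ (2 * d + 1))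
    (hsymm : ∀ i j, Valued.v (M i j - M j.rev i.rev) ≤ Valued.v ϖ ^ (d + 1))
    (c ε : K) (hc : Valued.v c = 1) (hεv : Valued.v ε = 1) (hε : ∀ z : K, Valued.v z ≤ 1 → Valued.v (z ^ 2 - ε) = 1) :
    ((∃ x ∈ stdLattice K 2, ∃ a : K, Valued.v a = 1 ∧
          Valued.v ((ϖ ^ d)⁻¹ * pairing σ ((StdForm.antidiagonal 2).over K) x (M *ᵥ x) - c * a ^ 2) < 1) ∨
        (∃ x ∈ stdLattice K 2, ∃ a : K, Valued.v a = 1 ∧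
          Valued.v ((ϖ ^ d)⁻¹ * pairing σ ((StdForm.antidiagonal 2).over K) x (M *ᵥ x) - (c * ε) * a ^ 2) < 1)) ∧
      ¬ ((∃ x ∈ stdLattice K 2, ∃ a : K, Valued.v a = 1 ∧
            Valued.v ((ϖ ^ d)⁻¹ * pairing σ ((StdForm.antidiagonal 2).over K) x (M *ᵥ x) - c * a ^ 2) < 1) ∧
          (∃ x ∈ stdLattice K 2, ∃ a : K, Valued.v a = 1 ∧
            Valued.v ((ϖ ^ d)⁻¹ * pairing σ ((StdForm.antidiagonal 2).over K) x (M *ᵥ x) - (c * ε) * a ^ 2) < 1)) := by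
  -- residual characteristic is not `2`
  have h2k : (2 : 𝓀[K]) ≠ 0 := by
    intro h0
    have h0' : IsLocalRing.residue 𝒪[K] 2 = 0 := by rwa [map_ofNat]
    rw [residue_eq_zero_iff_v_lt_one] at h0'
    have e2 : ((2 : 𝒪[K]) : K) = 2 := by norm_cast
    rw [e2, h2] at h0'
    exact lt_irrefl _ h0'
  -- the residual leading matrix
  obtain ⟨Y₀, hY₀⟩ := exists_integer_matrix_eq_inv_pow_mul_fin hϖ M hM
  have hsymm' : ∀ i j, Y₀.map (IsLocalRing.residue 𝒪[K]) i j = Y₀.map (IsLocalRing.residue 𝒪[K]) j.rev i.rev :=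
    map_residue_apply_eq_rev_of_sub_le_fin hϖ M Y₀ hY₀ hsymm
  have hsq0 := map_residue_mul_self_eq_zero_of_sq_le_fin hϖ M Y₀ hY₀ hsq
  have hne0 := map_residue_ne_zero_of_not_forall_le_succ_fin hϖ M Y₀ hY₀ hM'
  -- residues of the constants
  have hcε : Valued.v (c * ε) ≤ 1 := by rw [map_mul, hc, hεv, one_mul]
  have hc0 : IsLocalRing.residue 𝒪[K] ⟨c, (Valuation.mem_integer_iff _ _).2 hc.le⟩ ≠ 0 := by
    rw [Ne, residue_eq_zero_iff_v_lt_one]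
    exact fun h => (ne_of_lt h) hc
  have hεns : ¬ IsSquare (IsLocalRing.residue 𝒪[K] ⟨ε, (Valuation.mem_integer_iff _ _).2 hεv.le⟩) := by
    rintro ⟨r, hr⟩
    obtain ⟨z, rfl⟩ := IsLocalRing.residue_surjective r
    have h1 := hε z z.2
    have h0 : IsLocalRing.residue 𝒪[K] (z ^ 2 - ⟨ε, (Valuation.mem_integer_iff _ _).2 hεv.le⟩) = 0 := by
      rw [map_sub, map_pow, hr, pow_two, sub_self]
    rw [residue_eq_zero_iff_v_lt_one] at h0
    push_cast at h0
    exact (ne_of_lt h0) h1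
  have hmul : IsLocalRing.residue 𝒪[K] ⟨c * ε, (Valuation.mem_integer_iff _ _).2 hcε⟩ =
      IsLocalRing.residue 𝒪[K] ⟨c, (Valuation.mem_integer_iff _ _).2 hc.le⟩ * IsLocalRing.residue 𝒪[K] ⟨ε, (Valuation.mem_integer_iff _ _).2 hεv.le⟩ := by
    rw [← map_mul]; rfl
  have hR := represents_xor_represents_mul_of_symm_of_mul_self_eq_zero_two h2k (Y₀.map (IsLocalRing.residue 𝒪[K])) hsymm' hsq0 hne0 hc0 hεns
  rw [exists_mem_stdLattice_depthClass_iff_residue_two hvσ hres hϖ M Y₀ hY₀ c hc.le, exists_mem_stdLattice_depthClass_iff_residue_two hvσ hres hϖ M Y₀ hY₀ (c * ε) hcε, hmul]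
  exact hR

/-! ## §2 Transport of the CENTRED class token from `u·L₀` to `L₀` -/

/-- **THE CENTRED CLASS TOKEN AT `u·L₀` IS THE ONE AT `L₀` FOR `u⁻¹γu − c·1`** (any form `H`, any rank; `u` unitary: `⟨u x, (γ − c·1)(u x)⟩_H = ⟨x, (u⁻¹γu − c·1) x⟩_H`;
any scalar `r`, any constant `t`). [cite: BruhatTits1972, §10] [cite: Kottwitz1986, §3] -/
theorem exists_mem_mapGL_stdLattice_centredClass_iff_fin {N : ℕ} {H : Matrix (Fin N) (Fin N) K} (u γ : unitaryGroupOfForm σ H) (c r t : K) :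
    (∃ y ∈ mapGL (u : GL (Fin N) K) (stdLattice K N), ∃ a : K, Valued.v a = 1 ∧
        Valued.v (r * pairing σ H y ((((γ : GL (Fin N) K) : Matrix (Fin N) (Fin N) K) - c • (1 : Matrix (Fin N) (Fin N) K)) *ᵥ y) - t * a ^ 2) < 1) ↔
      ∃ x ∈ stdLattice K N, ∃ a : K, Valued.v a = 1 ∧
        Valued.v (r * pairing σ H x
          ((((((u : GL (Fin N) K)⁻¹ * (γ : GL (Fin N) K) * (u : GL (Fin N) K) : GL (Fin N) K)) : Matrix (Fin N) (Fin N) K) - c • (1 : Matrix (Fin N) (Fin N) K)) *ᵥ x) - t * a ^ 2) < 1 := by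
  have hmat : ∀ x : Fin N → K,
      ((((γ : GL (Fin N) K) : Matrix (Fin N) (Fin N) K) - c • (1 : Matrix (Fin N) (Fin N) K)) *ᵥ (((u : GL (Fin N) K) : Matrix (Fin N) (Fin N) K) *ᵥ x)) =
        ((u : GL (Fin N) K) : Matrix (Fin N) (Fin N) K) *ᵥ
          ((((((u : GL (Fin N) K)⁻¹ * (γ : GL (Fin N) K) * (u : GL (Fin N) K) : GL (Fin N) K)) : Matrix (Fin N) (Fin N) K) - c • (1 : Matrix (Fin N) (Fin N) K)) *ᵥ x) :=
    fun x => sub_smul_one_mulVec_coe_mulVec _ _ c x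
  have hinv : ∀ y : Fin N → K, ((u : GL (Fin N) K) : Matrix (Fin N) (Fin N) K) *ᵥ ((((u : GL (Fin N) K)⁻¹ : GL (Fin N) K) : Matrix (Fin N) (Fin N) K) *ᵥ y) = y :=
    fun y => by rw [Matrix.mulVec_mulVec, ← Units.val_mul, mul_inv_cancel, Units.val_one, Matrix.one_mulVec]
  constructor
  · rintro ⟨y, hy, a, ha, hlt⟩
    rw [mem_mapGL_iff] at hy
    refine ⟨(((u : GL (Fin N) K)⁻¹ : GL (Fin N) K) : Matrix (Fin N) (Fin N) K) *ᵥ y, hy, a, ha, ?_⟩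
    rw [← pairing_mulVec_mulVec_of_mem_unitary u.2, ← hmat, hinv]
    exact hlt
  · rintro ⟨x, hx, a, ha, hlt⟩
    refine ⟨((u : GL (Fin N) K) : Matrix (Fin N) (Fin N) K) *ᵥ x, ?_, a, ha, ?_⟩
    · rw [mem_mapGL_iff, Matrix.mulVec_mulVec, ← Units.val_mul, inv_mul_cancel, Units.val_one, Matrix.one_mulVec]
      exact hx
    · rw [hmat, pairing_mulVec_mulVec_of_mem_unitary u.2]
      exact hlt

/-! ## §3 The centred vertex form -/

/-- **ROW-1C IN RANK 2, CENTRED (vertex form, form-keyed).**  `H₂ = antidiag(1,1)` (hypothesis), `Γ ∈ U(σ, H₂)`, a scalar `c` with `|c − 1| ≤ |ϖ|^d`, `d` ODD, a self-dual `B` with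
the PLAIN level token `(Γ−1)B ⊆ ϖ^d B`, exact CENTRED depth `d` (`¬(Γ − c·1)B ⊆ ϖ^{d+1}B`) and centred rank one (`(Γ − c·1)²B ⊆ ϖ^{2d+1}B`); a unit `t` and a residual non-square
unit `ε`: EXACTLY ONE of `CLS^c_d(t)`, `CLS^c_d(t·ε)` holds, `CLS^c_d(t)(B) :⟺ ∃ y ∈ B, a ∈ 𝒪^×, |ϖ^{−d}⟨y, (Γ − c·1)y⟩ − t·a²| < 1`.  (`B = u·L₀` by ★ rank-2 transitivity;
`M := u⁻¹Γu − c·1 = (u⁻¹Γu − 1) − (c−1)·1` is `J`-symmetric one order down: the first summand by unitarity at odd `d` (★ `v_coe_sub_one_apply_sub_rev_le_of_odd_fin`), the scalar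
exactly; then §1 and §2.) [cite: Rogawski1990, §4.9 p. 55] [cite: Kottwitz1986, §3] [cite: LabesseLanglands1979, §2 Lemma 2.1] -/
theorem class_xor_class_mul_of_selfDual_rankOne_two_centred_of_eq (hσ : ∀ x, σ (σ x) = x) (hvσ : ∀ a, Valued.v (σ a) = Valued.v a) (hσϖ : σ ϖ = -ϖ)
    (hϖ : Valued.v ϖ = WithZero.exp (-1 : ℤ)) (hres : ∀ x : K, Valued.v x ≤ 1 → Valued.v (σ x - x) < 1) (h2 : Valued.v (2 : K) = 1) [Finite 𝓀[K]]
    {H₂ : Matrix (Fin 2) (Fin 2) K} (hH : H₂ = (StdForm.antidiagonal 2).over K) (γ : unitaryGroupOfForm σ H₂) (c : K)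
    {d : ℕ} (hd : Odd d) (hcd : Valued.v (c - 1) ≤ Valued.v ϖ ^ d)
    {B : Submodule 𝒪[K] (Fin 2 → K)} (hB : IsSelfDualLattice σ ϖ H₂ B)
    (hplain : B.map ((Matrix.toLin' (((γ : GL (Fin 2) K) : Matrix (Fin 2) (Fin 2) K) - 1)).restrictScalars 𝒪[K]) ≤ scaleLattice (ϖ ^ d) B)
    (hlev' : ¬ B.map ((Matrix.toLin' (((γ : GL (Fin 2) K) : Matrix (Fin 2) (Fin 2) K) - c • (1 : Matrix (Fin 2) (Fin 2) K))).restrictScalars 𝒪[K]) ≤ scaleLattice (ϖ ^ (d + 1)) B)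
    (hrk : B.map ((Matrix.toLin' ((((γ : GL (Fin 2) K) : Matrix (Fin 2) (Fin 2) K) - c • (1 : Matrix (Fin 2) (Fin 2) K)) ^ 2)).restrictScalars 𝒪[K]) ≤ scaleLattice (ϖ ^ (2 * d + 1)) B)
    (t ε : K) (ht : Valued.v t = 1) (hεv : Valued.v ε = 1) (hε : ∀ z : K, Valued.v z ≤ 1 → Valued.v (z ^ 2 - ε) = 1) :
    ((∃ y ∈ B, ∃ a : K, Valued.v a = 1 ∧ Valued.v ((ϖ ^ d)⁻¹ * pairing σ H₂ y ((((γ : GL (Fin 2) K) : Matrix (Fin 2) (Fin 2) K) - c • (1 : Matrix (Fin 2) (Fin 2) K)) *ᵥ y) - t * a ^ 2) < 1) ∨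
        (∃ y ∈ B, ∃ a : K, Valued.v a = 1 ∧ Valued.v ((ϖ ^ d)⁻¹ * pairing σ H₂ y ((((γ : GL (Fin 2) K) : Matrix (Fin 2) (Fin 2) K) - c • (1 : Matrix (Fin 2) (Fin 2) K)) *ᵥ y) - (t * ε) * a ^ 2) < 1)) ∧
      ¬ ((∃ y ∈ B, ∃ a : K, Valued.v a = 1 ∧ Valued.v ((ϖ ^ d)⁻¹ * pairing σ H₂ y ((((γ : GL (Fin 2) K) : Matrix (Fin 2) (Fin 2) K) - c • (1 : Matrix (Fin 2) (Fin 2) K)) *ᵥ y) - t * a ^ 2) < 1) ∧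
        (∃ y ∈ B, ∃ a : K, Valued.v a = 1 ∧ Valued.v ((ϖ ^ d)⁻¹ * pairing σ H₂ y ((((γ : GL (Fin 2) K) : Matrix (Fin 2) (Fin 2) K) - c • (1 : Matrix (Fin 2) (Fin 2) K)) *ᵥ y) - (t * ε) * a ^ 2) < 1)) := by
  subst hH
  have hϖ0 : ϖ ≠ 0 := fun h0 => by rw [h0, map_zero] at hϖ; exact WithZero.coe_ne_zero hϖ.symm
  have hϖ1 : Valued.v ϖ ≤ 1 := by rw [hϖ, ← WithZero.exp_zero]; exact WithZero.exp_le_exp.2 (by norm_num)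
  -- `B = u·L₀`
  obtain ⟨u, hu⟩ := exists_unitary_mapGL_stdLattice_eq_of_isSelfDualLattice_two_of_v_two hσ hvσ hϖ h2 hB
  subst hu
  set M : Matrix (Fin 2) (Fin 2) K :=
    (((((u : GL (Fin 2) K)⁻¹ * (γ : GL (Fin 2) K) * (u : GL (Fin 2) K) : GL (Fin 2) K)) : Matrix (Fin 2) (Fin 2) K) - c • (1 : Matrix (Fin 2) (Fin 2) K)) with hMdef
  -- the plain token as entry bounds on `Y − 1`, `Y = u⁻¹γu`
  have hY1 : ∀ i j, Valued.v (((((u⁻¹ * γ * u : unitaryGroupOfForm σ ((StdForm.antidiagonal 2).over K)) : GL (Fin 2) K) : Matrix (Fin 2) (Fin 2) K) - 1) i j) ≤ Valued.v ϖ ^ d :=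
    fun i j => by rw [← map_pow]; exact (forall_v_conj_sub_one_le_iff_map_sub_one_le_scaleLattice γ u (pow_ne_zero _ hϖ0)).1 hplain i j
  have hcoe : ((((u⁻¹ * γ * u : unitaryGroupOfForm σ ((StdForm.antidiagonal 2).over K)) : GL (Fin 2) K) : Matrix (Fin 2) (Fin 2) K)) =
      ((((u : GL (Fin 2) K)⁻¹ * (γ : GL (Fin 2) K) * (u : GL (Fin 2) K) : GL (Fin 2) K)) : Matrix (Fin 2) (Fin 2) K) := by
    rw [Subgroup.coe_mul, Subgroup.coe_mul, Subgroup.coe_inv]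
  have hMsplit : ∀ i j, M i j = ((((u⁻¹ * γ * u : unitaryGroupOfForm σ ((StdForm.antidiagonal 2).over K)) : GL (Fin 2) K) : Matrix (Fin 2) (Fin 2) K) - 1) i j - (c - 1) * (1 : Matrix (Fin 2) (Fin 2) K) i j := by
    intro i j
    rw [hMdef, ← hcoe, Matrix.sub_apply, Matrix.sub_apply, Matrix.smul_apply, smul_eq_mul]
    ring
  have h1ij : ∀ i j : Fin 2, Valued.v ((1 : Matrix (Fin 2) (Fin 2) K) i j) ≤ 1 := fun i j => by
    rcases eq_or_ne i j with hij | hij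
    · rw [hij, Matrix.one_apply_eq, map_one]
    · rw [Matrix.one_apply_ne hij, map_zero]; exact zero_le
  -- (a) entries of `M`
  have hM : ∀ i j, Valued.v (M i j) ≤ Valued.v ϖ ^ d := fun i j => by
    rw [hMsplit]
    refine (Valuation.map_sub _ _ _).trans (max_le (hY1 i j) ?_)
    rw [map_mul]
    exact (mul_le_of_le_one_right' (h1ij i j)).trans hcd
  -- (b) exact centred depth
  have hM' : ¬ ∀ i j, Valued.v (M i j) ≤ Valued.v ϖ ^ (d + 1) := fun h =>
    hlev' ((forall_v_coe_conj_sub_smul_le_iff_map_le_scaleLattice (pow_ne_zero (d + 1) hϖ0) (γ : GL (Fin 2) K) (u : GL (Fin 2) K) c).1 fun a b => by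
      rw [map_pow]; exact h a b)
  -- (c) the centred square
  have hsq : ∀ i j, Valued.v ((M * M) i j) ≤ Valued.v ϖ ^ (2 * d + 1) := fun i j => by
    have h := (map_toLin'_mapGL_stdLattice_le_scaleLattice_iff (pow_ne_zero (2 * d + 1) hϖ0)
      ((((γ : GL (Fin 2) K) : Matrix (Fin 2) (Fin 2) K) - c • (1 : Matrix (Fin 2) (Fin 2) K)) ^ 2) (u : GL (Fin 2) K)).1 hrk i j
    rw [inv_mul_sq_mul_eq_sq _ (Matrix.isUnits_det_units _), ← coe_inv_mul_mul_sub_smul_one_eq_conj, map_pow] at h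
    rw [← pow_two]
    exact h
  -- (d) `J`-symmetry one order down: the unitary part by unitarity at odd `d`, the scalar exactly
  have hsymm : ∀ i j, Valued.v (M i j - M j.rev i.rev) ≤ Valued.v ϖ ^ (d + 1) := fun i j => by
    have hrev : (1 : Matrix (Fin 2) (Fin 2) K) j.rev i.rev = (1 : Matrix (Fin 2) (Fin 2) K) i j := by
      rcases eq_or_ne i j with hij | hij
      · rw [hij, Matrix.one_apply_eq, Matrix.one_apply_eq]
      · rw [Matrix.one_apply_ne hij, Matrix.one_apply_ne (fun h => hij (Fin.rev_injective h).symm)]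
    rw [hMsplit, hMsplit, hrev]
    have e : ((((u⁻¹ * γ * u : unitaryGroupOfForm σ ((StdForm.antidiagonal 2).over K)) : GL (Fin 2) K) : Matrix (Fin 2) (Fin 2) K) - 1) i j - (c - 1) * (1 : Matrix (Fin 2) (Fin 2) K) i j -
        (((((u⁻¹ * γ * u : unitaryGroupOfForm σ ((StdForm.antidiagonal 2).over K)) : GL (Fin 2) K) : Matrix (Fin 2) (Fin 2) K) - 1) j.rev i.rev - (c - 1) * (1 : Matrix (Fin 2) (Fin 2) K) i j) =
        ((((u⁻¹ * γ * u : unitaryGroupOfForm σ ((StdForm.antidiagonal 2).over K)) : GL (Fin 2) K) : Matrix (Fin 2) (Fin 2) K) - 1) i j -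
          ((((u⁻¹ * γ * u : unitaryGroupOfForm σ ((StdForm.antidiagonal 2).over K)) : GL (Fin 2) K) : Matrix (Fin 2) (Fin 2) K) - 1) j.rev i.rev := by ring
    rw [e]
    exact v_coe_sub_one_apply_sub_rev_le_of_odd_fin hvσ hσϖ hϖ hres (u⁻¹ * γ * u) hd hY1 i j
  have h1 := class_xor_class_mul_stdLattice_of_symm_rankOne_two hvσ hϖ hres h2 M hM hM' hsq hsymm t ε ht hεv hε
  have e1 := exists_mem_mapGL_stdLattice_centredClass_iff_fin u γ c ((ϖ ^ d)⁻¹) t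
  have e2 := exists_mem_mapGL_stdLattice_centredClass_iff_fin u γ c ((ϖ ^ d)⁻¹) (t * ε)
  rw [e1, e2]
  exact h1

end Literature.NumberTheory.Automorphic.UnitaryLatticeTree

end
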